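import Mathlib
import HarnessLib
import Literature.LinearAlgebra.Matrix.ChordalPositiveSemidefinite

/-!
# The elimination tree and the cliques of a filled (chordal) graph
(Vandenberghe–Andersen 2015, §4.3–§4.4)

A companion to `ChordalPositiveSemidefinite` (which introduced ordered sparsity graphs
`E : ι → ι → Prop` on a linearly ordered vertex type, MONOTONE TRANSITIVITY = the order is a
perfect elimination ordering, and the closed higher neighbourhoods `col(v) = clique E v`).  This
file records the combinatorics of the ELIMINATION TREE of a filled graph and of its CLIQUES —
the structure behind clique trees, supernodes and the clique decompositions / conversions used for
sparse semidefinite programming ([VA15, §4.3–§4.4]; Liu; Lewis–Peyton–Pothen; Pothen–Sun):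

* `higherAdj E u` — `adj⁺(u) = {v ≻ u | {u,v} ∈ E}`, with `col(u) = {u} ∪ adj⁺(u)`
  (`clique_eq_insert_higherAdj`); `deg⁺(u) = |adj⁺(u)|` is `(higherAdj E u).ncard`.
* `IsParent E u w` — the PARENT FUNCTION `w = p(u) =` the first vertex of `adj⁺(u)`
  ([VA15, §4.3, p. 278]); unique (`IsParent.unique`), exists whenever `adj⁺(u) ≠ ∅`
  (`exists_isParent`), and `u ≺ p(u)` (`IsParent.lt`: the parent graph is a forest topologically
  ordered by the vertex order).

For a MONOTONE TRANSITIVE (filled) `E`: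

* `higherAdj_subset_clique_parent` — **[VA15, (4.3)]** `adj⁺(u) ⊆ col(p(u))`; hence
  `col(u) ∩ col(p(u)) = adj⁺(u)` (`clique_inter_clique_parent`: clique separator / residual `{u}`
  of the junction tree obtained from the elimination tree) and the running-intersection seed
  `col(u) ∩ col(x) ⊆ col(p(u))` for every `x ≻ u` (`clique_inter_clique_subset_clique_parent`).
* `transGen_isParent_of_adj` — **[VA15, (4.4)]**: adjacent vertices are ancestor–descendant pairs
  of the elimination tree (`u ≺ v`, `{u,v} ∈ E ⟹ v = pᵏ(u)`, `k ≥ 1`, as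
  `Relation.TransGen (IsParent E) u v`), and the ROW SUBTREE property
  `mem_clique_of_mem_higherAdj_of_transGen`: a higher neighbour `v` of `u` lies in `col(a)` for
  every ancestor `a = pᵏ(u) ≤ v`.
* `ncard_higherAdj_le_parent` — **[VA15, (4.5), k = 1]** `deg⁺(u) ≤ deg⁺(p(u)) + 1`, with equality
  iff `adj⁺(u) = col(p(u))`.
* `subset_clique_of_pairwise_of_isLeast`, **`eq_clique_of_maximal_pairwise`** — [VA15, §4.4]:
  every complete set lies in `col(v)` of its lowest vertex, so every CLIQUE (maximal complete set,
  `Maximal (·.Pairwise E)`) is `col(v)` for its REPRESENTATIVE VERTEX `v`; two cliques with the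
  same lowest vertex coincide (`eq_of_maximal_pairwise_of_isLeast`: at most `n` cliques).
* **`not_maximal_clique_iff_exists_child`**, `maximal_clique_iff_forall_child_ncard_lt` —
  **[VA15, Thm 4.2]**, the representative-vertex criterion: `col(v)` is a clique iff no child `w`
  of `v` has `adj⁺(w) = col(v)`, iff `deg⁺(w) < deg⁺(v) + 1` for all children `w`.  (Our proof of
  the hard direction replaces the path argument of [VA15] by a maximality argument: if
  `col(v) ⊊ W'` complete with lowest vertex `u ≺ v`, the LARGEST `u' ≺ v` with `col(v) ⊆ adj⁺(u')`
  is a child of `v`, by (4.3).)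
* `simpleGraph_eq_clique_of_maximal_isClique` — the `SimpleGraph` / `Maximal G.IsClique` form.

Complete sets are `Set.Pairwise W E` (= `G.IsClique W` for a `SimpleGraph`), cliques are
`Maximal (fun W => W.Pairwise E) W` (Mathlib's `Maximal`).  Finiteness of the vertex type is
assumed where parents, lowest or largest vertices are chosen.

NOT in this file: connectedness and the single root `σ(n)`, the general-`k` forms of (4.4)–(4.5)
with levels `lev(u)`, maximal supernodes and the supernodal elimination tree [VA15, (4.7)–(4.10),
Thm 4.3], clique trees with the induced-subtree property in general [VA15, §3.5–§3.7], the
topological-order algorithms (Algorithm 4.1, maximum cardinality search §4.7), and the count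
"at most `n - 1` cliques if connected".

References (keys of `lean/references.bib`): [VandenbergheAndersen2015] L. Vandenberghe,
M. S. Andersen, *Chordal graphs and semidefinite optimization*, Found. Trends Optim. 1 (2015)
241–433, doi:10.1561/2400000006 — §4.1 eq. (4.1) (monotone transitivity, p. 274), §4.3
"Elimination tree" (pp. 278–282: parent function, (4.3)–(4.5), row subtrees, junction tree of Fig. 4.3) and §4.4 "Clique tree from elimination tree"
(pp. 282–283: representative vertices, Thm 4.2 with (4.6)); page checks against the authors' copy
held as `lit` key `paper:url-1b9fdea6a8a3` (PDF p. = book p. − 236).  [VA15] attributes the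
representative-vertex description of the cliques to Fulkerson–Gross (Pacific J. Math. 15 (1965),
p. 852), Gavril (SIAM J. Comput. 1 (1972), p. 183) and Lewis–Peyton–Pothen (SIAM J. Sci. Statist.
Comput. 10 (1989), Prop. 2), and Thm 4.2 to Pothen–Sun (in *Large-Scale Numerical Optimization*,
SIAM 1990, p. 185) — their references [88], [91], [150], [188].
-/

namespace Literature.LinearAlgebra.Matrix

namespace ChordalSparsity

variable {ι : Type*}

/-! ### Higher neighbourhoods and the parent function -/

section Parent

variable [LinearOrder ι]

/-- The (open) HIGHER NEIGHBOURHOOD `adj⁺(u) = {v ≻ u | {u,v} ∈ E}` of a vertex of an ordered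
graph; `col(u) = {u} ∪ adj⁺(u)` (`clique E u`), and `deg⁺(u) = |adj⁺(u)|` is the higher degree.
[cite: VandenbergheAndersen2015, §2.2 (pp. 247–248) and §4.3 (p. 280)] -/
def higherAdj (E : ι → ι → Prop) (u : ι) : Set ι :=
  {v | u < v ∧ E u v}

/-- Membership in `adj⁺(u)`. [cite: VandenbergheAndersen2015, §2.2 (pp. 247–248)] -/
theorem mem_higherAdj_iff {E : ι → ι → Prop} {u v : ι} : v ∈ higherAdj E u ↔ u < v ∧ E u v :=
  Iff.rfl

/-- `u ∉ adj⁺(u)`. [cite: VandenbergheAndersen2015, §2.2 (pp. 247–248)] -/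
theorem not_mem_higherAdj_self (E : ι → ι → Prop) (u : ι) : u ∉ higherAdj E u :=
  fun h => lt_irrefl u h.1

/-- `col(u) = {u} ∪ adj⁺(u)`. [cite: VandenbergheAndersen2015, §2.2 (pp. 247–248)] -/
theorem clique_eq_insert_higherAdj (E : ι → ι → Prop) (u : ι) :
    clique E u = insert u (higherAdj E u) := by
  ext v
  rw [mem_clique_iff, Set.mem_insert_iff, mem_higherAdj_iff]

/-- Every member of `col(u)` is `≥ u`. [cite: VandenbergheAndersen2015, §2.2 (pp. 247–248)] -/
theorem le_of_mem_clique {E : ι → ι → Prop} {u v : ι} (hv : v ∈ clique E u) : u ≤ v := by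
  rcases mem_clique_iff.mp hv with rfl | ⟨huv, -⟩
  · exact le_rfl
  · exact huv.le

/-- A member of `col(u)` other than `u` lies in `adj⁺(u)`.
[cite: VandenbergheAndersen2015, §2.2 (pp. 247–248)] -/
theorem mem_higherAdj_of_mem_clique_of_ne {E : ι → ι → Prop} {u v : ι} (hv : v ∈ clique E u)
    (hne : v ≠ u) : v ∈ higherAdj E u := by
  rcases mem_clique_iff.mp hv with rfl | h
  · exact absurd rfl hne
  · exact h

/-- THE PARENT FUNCTION OF THE ELIMINATION TREE ([VA15, §4.3, p. 278]): `w = p(u)` is the parent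
of `u` if it is the FIRST (lowest) vertex of `adj⁺(u)`,
`p(u) = argmin {σ⁻¹(v) | v ∈ adj⁺(u)}`.  Vertices with empty `adj⁺(u)` (the root, or the roots of
the components) have no parent.  Stated as a relation `IsParent E u w`.
[cite: VandenbergheAndersen2015, §4.3 (p. 278)] -/
def IsParent (E : ι → ι → Prop) (u w : ι) : Prop :=
  w ∈ higherAdj E u ∧ ∀ ⦃v⦄, v ∈ higherAdj E u → w ≤ v

/-- The parent is a higher neighbour: `u ≺ p(u)` and `{u, p(u)} ∈ E` — so the graph with edges
`{u, p(u)}` is acyclic and the ordering is a topological ordering of it ([VA15, §4.3]).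
[cite: VandenbergheAndersen2015, §4.3 (p. 279)] -/
theorem IsParent.lt {E : ι → ι → Prop} {u w : ι} (h : IsParent E u w) : u < w :=
  h.1.1

/-- `{u, p(u)} ∈ E`. [cite: VandenbergheAndersen2015, §4.3 (p. 279)] -/
theorem IsParent.adj {E : ι → ι → Prop} {u w : ι} (h : IsParent E u w) : E u w :=
  h.1.2

/-- `p(u) ≤ v` for every `v ∈ adj⁺(u)`. [cite: VandenbergheAndersen2015, §4.3 (p. 278)] -/
theorem IsParent.le {E : ι → ι → Prop} {u w v : ι} (h : IsParent E u w) (hv : v ∈ higherAdj E u) :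
    w ≤ v :=
  h.2 hv

/-- The parent is unique. [cite: VandenbergheAndersen2015, §4.3 (p. 278)] -/
theorem IsParent.unique {E : ι → ι → Prop} {u w w' : ι} (h : IsParent E u w)
    (h' : IsParent E u w') : w = w' :=
  le_antisymm (h.2 h'.1) (h'.2 h.1)

/-- "The parent function is well defined because `adj⁺(u)` is non-empty": every vertex with a
higher neighbour has a (unique) parent (finite vertex set).
[cite: VandenbergheAndersen2015, §4.3 (p. 278)] -/
theorem exists_isParent [Finite ι] {E : ι → ι → Prop} {u : ι} (h : (higherAdj E u).Nonempty) :
    ∃ w, IsParent E u w := by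
  obtain ⟨w, hw, hmin⟩ := Set.exists_min_image (higherAdj E u) id (Set.toFinite _) h
  exact ⟨w, hw, fun v hv => hmin v hv⟩

end Parent

/-! ### Monotone transitivity: `adj⁺(u) ⊆ col(p(u))`, ancestors, higher degrees -/

section Tree

variable [LinearOrder ι]

/-- **[VA15, (4.3)]** `adj⁺(u) ⊆ col(p(u)) = {p(u)} ∪ adj⁺(p(u))` for every non-root vertex `u` of
a filled (monotone transitive) ordered graph: "monotone transitivity implies that all elements of
`adj⁺(u)` are mutually adjacent", and they all lie above `p(u)`, the lowest of them.  This is the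
inclusion that makes the expanded elimination tree a junction tree (clique separator
`sep(col(u)) ⊆` parent clique).
[cite: VandenbergheAndersen2015, §4.3 eq. (4.3) (p. 279)] -/
theorem higherAdj_subset_clique_parent {E : ι → ι → Prop} (hEm : MonotoneTransitive E) {u w : ι}
    (hw : IsParent E u w) : higherAdj E u ⊆ clique E w := by
  intro v hv
  by_cases hvw : v = w
  · exact mem_clique_iff.mpr (Or.inl hvw)
  · have hle : w ≤ v := hw.le hv
    exact mem_clique_iff.mpr (Or.inr ⟨lt_of_le_of_ne hle (Ne.symm hvw),
      hEm hw.lt hv.1 (Ne.symm hvw) hw.adj hv.2⟩)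

/-- (4.3) in the form `adj⁺(u) ⊆ {p(u)} ∪ adj⁺(p(u))`.
[cite: VandenbergheAndersen2015, §4.3 eq. (4.3) (p. 279)] -/
theorem higherAdj_subset_insert_higherAdj_parent {E : ι → ι → Prop} (hEm : MonotoneTransitive E)
    {u w : ι} (hw : IsParent E u w) : higherAdj E u ⊆ insert w (higherAdj E w) := by
  rw [← clique_eq_insert_higherAdj]
  exact higherAdj_subset_clique_parent hEm hw

/-- (4.3) for the closed neighbourhoods: `col(u) ⊆ {u} ∪ col(p(u))`.
[cite: VandenbergheAndersen2015, §4.3 eq. (4.3) (p. 279)] -/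
theorem clique_subset_insert_clique_parent {E : ι → ι → Prop} (hEm : MonotoneTransitive E)
    {u w : ι} (hw : IsParent E u w) : clique E u ⊆ insert u (clique E w) := by
  rw [clique_eq_insert_higherAdj]
  exact Set.insert_subset_insert (higherAdj_subset_clique_parent hEm hw)

/-- **[VA15, (4.4)]: ADJACENT VERTICES ARE ANCESTOR–DESCENDANT PAIRS IN THE ELIMINATION TREE.**
If `u ≺ v` are adjacent in a filled ordered graph (finite vertex set), then `v` is a proper
ancestor of `u`: `v = pᵏ(u)` for some `k ≥ 1`, i.e. `(u, v)` is in the transitive closure of the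
parent relation.  (Repeated application of (4.3): `v ∈ adj⁺(u) ⊆ col(p(u))`, so `v = p(u)` or
`v ∈ adj⁺(p(u))` with `p(u) ≻ u`; induction on `u` along the well-founded order `≻`.)
[cite: VandenbergheAndersen2015, §4.3 eq. (4.4) (p. 279)] -/
theorem transGen_isParent_of_adj [Finite ι] {E : ι → ι → Prop} (hEm : MonotoneTransitive E)
    {u v : ι} (huv : u < v) (hE : E u v) : Relation.TransGen (IsParent E) u v := by
  have key : ∀ u v : ι, u < v → E u v → Relation.TransGen (IsParent E) u v := by
    intro u
    refine @WellFounded.induction ι (· > ·) wellFounded_gt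
      (fun u => ∀ v : ι, u < v → E u v → Relation.TransGen (IsParent E) u v) u fun u ih => ?_
    intro v huv hE
    obtain ⟨w, hw⟩ := exists_isParent (E := E) ⟨v, huv, hE⟩
    by_cases hvw : v = w
    · subst hvw
      exact Relation.TransGen.single hw
    · have hv := mem_higherAdj_of_mem_clique_of_ne
        (higherAdj_subset_clique_parent hEm hw ⟨huv, hE⟩) hvw
      exact Relation.TransGen.head hw (ih w hw.lt v hv.1 hv.2)
  exact key u v huv hE

/-- Every proper ancestor `pᵏ(u)` lies strictly above `u` (the ordering is a topological ordering
of the elimination tree). [cite: VandenbergheAndersen2015, §4.3 (p. 279)] -/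
theorem lt_of_transGen_isParent {E : ι → ι → Prop} {u v : ι}
    (h : Relation.TransGen (IsParent E) u v) : u < v := by
  induction h with
  | single h => exact h.lt
  | tail _ h ih => exact lt_trans ih h.lt

/-- **[VA15, (4.4)] / THE ROW SUBTREES**: "if `v ∈ adj⁺(u)`, then `v ∈ col(w)` for all vertices
`w` on the path between `u` and `v` in the elimination tree" — if `v` is a higher neighbour of `u`
and `a = pᵏ(u)` is an ancestor of `u` with `a ≤ v`, then `v ∈ col(a)`.  (Induction along the path,
(4.3) at each step.) [cite: VandenbergheAndersen2015, §4.3 eq. (4.4) (pp. 279–280)] -/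
theorem mem_clique_of_mem_higherAdj_of_transGen {E : ι → ι → Prop} (hEm : MonotoneTransitive E)
    {u v a : ι} (hv : v ∈ higherAdj E u) (ha : Relation.TransGen (IsParent E) u a) (hav : a ≤ v) :
    v ∈ clique E a := by
  induction ha with
  | single h => exact higherAdj_subset_clique_parent hEm h hv
  | tail hab hbc ih =>
    have hb : v ∈ clique E _ := ih (le_trans hbc.lt.le hav)
    exact higherAdj_subset_clique_parent hEm hbc
      (mem_higherAdj_of_mem_clique_of_ne hb fun h => absurd hav (not_le.mpr (h ▸ hbc.lt)))

/-- THE JUNCTION TREE FROM THE ELIMINATION TREE ([VA15, §4.3, p. 280]): identifying each vertex `u`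
with `col(u)`, the intersection with the parent clique is the clique separator
`col(u) ∩ col(p(u)) = adj⁺(u)` and the residual is `{u}`.
[cite: VandenbergheAndersen2015, §4.3 (p. 280)] -/
theorem clique_inter_clique_parent {E : ι → ι → Prop} (hEm : MonotoneTransitive E) {u w : ι}
    (hw : IsParent E u w) : clique E u ∩ clique E w = higherAdj E u := by
  ext v
  constructor
  · rintro ⟨hvu, hvw⟩
    exact mem_higherAdj_of_mem_clique_of_ne hvu fun h =>
      absurd (le_of_mem_clique hvw) (not_le.mpr (h ▸ hw.lt))
  · intro hv
    exact ⟨(clique_eq_insert_higherAdj E u).symm ▸ Set.mem_insert_of_mem u hv,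
      higherAdj_subset_clique_parent hEm hw hv⟩

/-- THE RUNNING-INTERSECTION (INDUCED-SUBTREE) SEED: for every later vertex `x ≻ u`,
`col(u) ∩ col(x) ⊆ col(p(u))` — whatever `col(u)` shares with any later clique already lies in its
parent clique ([VA15, §4.3–§4.4]: the expanded elimination tree is a junction tree).
[cite: VandenbergheAndersen2015, §4.3 (p. 280)] -/
theorem clique_inter_clique_subset_clique_parent {E : ι → ι → Prop} (hEm : MonotoneTransitive E)
    {u w x : ι} (hw : IsParent E u w) (hx : u < x) : clique E u ∩ clique E x ⊆ clique E w := by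
  rintro v ⟨hvu, hvx⟩
  exact higherAdj_subset_clique_parent hEm hw (mem_higherAdj_of_mem_clique_of_ne hvu fun h =>
    absurd (le_of_mem_clique hvx) (not_le.mpr (h ▸ hx)))

/-- **THE HIGHER-DEGREE INEQUALITY [VA15, (4.5), `k = 1`]**: `deg⁺(u) ≤ 1 + deg⁺(p(u))`, with
equality if and only if `adj⁺(u) = {p(u)} ∪ adj⁺(p(u)) = col(p(u))` (finite vertex set;
`deg⁺ = |adj⁺|` as `Set.ncard`). [cite: VandenbergheAndersen2015, §4.3 eq. (4.5) (p. 280)] -/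
theorem ncard_higherAdj_le_parent [Finite ι] {E : ι → ι → Prop} (hEm : MonotoneTransitive E)
    {u w : ι} (hw : IsParent E u w) :
    (higherAdj E u).ncard ≤ (higherAdj E w).ncard + 1 ∧
      ((higherAdj E u).ncard = (higherAdj E w).ncard + 1 ↔ higherAdj E u = clique E w) := by
  have hsub := higherAdj_subset_clique_parent hEm hw
  have hcol : (clique E w).ncard = (higherAdj E w).ncard + 1 := by
    rw [clique_eq_insert_higherAdj, Set.ncard_insert_of_notMem (not_mem_higherAdj_self E w)]
  refine ⟨hcol ▸ Set.ncard_le_ncard hsub, fun h => ?_, fun h => by rw [h, hcol]⟩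
  exact Set.eq_of_subset_of_ncard_le hsub (by rw [hcol, h])

end Tree

/-! ### Cliques and representative vertices -/

section Cliques

variable [LinearOrder ι]

/-- Every `col(v)` of a filled ordered graph is a complete set (`Set.Pairwise`).
[cite: VandenbergheAndersen2015, §4.1 eq. (4.1) (p. 274)] -/
theorem pairwise_clique {E : ι → ι → Prop} (hEs : ∀ ⦃i j : ι⦄, E i j → E j i)
    (hEm : MonotoneTransitive E) (v : ι) : (clique E v).Pairwise E :=
  fun _ hi _ hj hij => clique_complete hEs hEm v hi hj hij

/-- **EVERY COMPLETE SET LIES IN `col(v)` OF ITS LOWEST VERTEX** ([VA15, §4.4]: "every vertex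
`w ≠ v` in the clique belongs to `adj⁺(v)`, since `w ≻ v` by choice of `v`, and `w` and `v` are
adjacent ... therefore `W ⊆ col(v)`") — for ANY ordered graph.
[cite: VandenbergheAndersen2015, §4.4 (p. 282)] -/
theorem subset_clique_of_pairwise_of_isLeast {E : ι → ι → Prop} {W : Set ι} (hW : W.Pairwise E)
    {v : ι} (hv : IsLeast W v) : W ⊆ clique E v := by
  intro w hw
  by_cases hwv : w = v
  · exact mem_clique_iff.mpr (Or.inl hwv)
  · exact mem_clique_iff.mpr (Or.inr ⟨lt_of_le_of_ne (hv.2 hw) (Ne.symm hwv),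
      hW hv.1 hw (Ne.symm hwv)⟩)

/-- **EVERY CLIQUE IS `col(v)` OF ITS REPRESENTATIVE VERTEX** ([VA15, §4.4, p. 282]; Fulkerson–Gross;
[88, p. 852], [91, p. 183], [150, Prop. 2] there): in a filled ordered graph with finite vertex set,
a maximal complete set `W` equals `col(v)` for its lowest vertex `v` (the REPRESENTATIVE VERTEX of
the clique). [cite: VandenbergheAndersen2015, §4.4 (p. 282)] -/
theorem eq_clique_of_maximal_pairwise [Finite ι] {E : ι → ι → Prop}
    (hEs : ∀ ⦃i j : ι⦄, E i j → E j i) (hEm : MonotoneTransitive E) {W : Set ι}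
    (hW : Maximal (fun W : Set ι => W.Pairwise E) W) (hne : W.Nonempty) :
    ∃ v, IsLeast W v ∧ W = clique E v := by
  obtain ⟨v, hv, hmin⟩ := Set.exists_min_image W id (Set.toFinite _) hne
  have hleast : IsLeast W v := ⟨hv, fun w hw => hmin w hw⟩
  exact ⟨v, hleast, hW.eq_of_subset (pairwise_clique hEs hEm v)
    (subset_clique_of_pairwise_of_isLeast hW.prop hleast)⟩

/-- Hence two cliques with the same lowest vertex coincide — a filled graph on `n` vertices has
at most `n` cliques (at most `n - 1` if connected, [VA15, §4.4]).
[cite: VandenbergheAndersen2015, §4.4 (p. 282)] -/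
theorem eq_of_maximal_pairwise_of_isLeast [Finite ι] {E : ι → ι → Prop}
    (hEs : ∀ ⦃i j : ι⦄, E i j → E j i) (hEm : MonotoneTransitive E) {W₁ W₂ : Set ι}
    (h₁ : Maximal (fun W : Set ι => W.Pairwise E) W₁) (h₂ : Maximal (fun W : Set ι => W.Pairwise E) W₂)
    {v : ι} (hv₁ : IsLeast W₁ v) (hv₂ : IsLeast W₂ v) : W₁ = W₂ := by
  obtain ⟨v₁, hv₁', h₁eq⟩ := eq_clique_of_maximal_pairwise hEs hEm h₁ ⟨v, hv₁.1⟩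
  obtain ⟨v₂, hv₂', h₂eq⟩ := eq_clique_of_maximal_pairwise hEs hEm h₂ ⟨v, hv₂.1⟩
  rw [h₁eq, h₂eq, hv₁'.unique hv₁, hv₂'.unique hv₂]

/-- If a child `w` of `v` has `adj⁺(w) = col(v)` then `col(v) ⊊ col(w)` is not a clique (the easy
half of [VA15, Thm 4.2]). [cite: VandenbergheAndersen2015, §4.4 Thm 4.2 (pp. 282–283)] -/
theorem not_maximal_clique_of_child {E : ι → ι → Prop} (hEs : ∀ ⦃i j : ι⦄, E i j → E j i)
    (hEm : MonotoneTransitive E) {v w : ι} (hw : IsParent E w v)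
    (heq : higherAdj E w = clique E v) : ¬ Maximal (fun W : Set ι => W.Pairwise E) (clique E v) := by
  intro hmax
  have hsub : clique E v ⊆ clique E w := by
    rw [clique_eq_insert_higherAdj E w, heq]
    exact Set.subset_insert _ _
  have hEq := hmax.eq_of_subset (pairwise_clique hEs hEm w) hsub
  have hwv : w ∈ clique E v := hEq ▸ mem_clique_self E w
  exact absurd (le_of_mem_clique hwv) (not_le.mpr hw.lt)

/-- **THE REPRESENTATIVE VERTEX CRITERION [VA15, Thm 4.2]** ([188, p. 185] there): in a filled
ordered graph with finite vertex set, `col(v)` is NOT a clique (a maximal complete set) if and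
only if some child `w` of `v` in the elimination tree has `adj⁺(w) = col(v)` — equivalently
`deg⁺(w) = deg⁺(v) + 1` (`ncard_higherAdj_le_parent`).  (If `col(v) ⊊ W'` complete, the lowest
vertex `u` of `W'` has `u ≺ v` and `col(v) ⊆ adj⁺(u)`; the LARGEST such `u` is a child of `v`:
its parent `p(u) ≤ v` cannot be `< v`, for then `col(v) ⊆ adj⁺(p(u))` by (4.3) with `p(u) ≻ u`.)
[cite: VandenbergheAndersen2015, §4.4 Thm 4.2 (pp. 282–283)] -/
theorem not_maximal_clique_iff_exists_child [Finite ι] {E : ι → ι → Prop}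
    (hEs : ∀ ⦃i j : ι⦄, E i j → E j i) (hEm : MonotoneTransitive E) (v : ι) :
    ¬ Maximal (fun W : Set ι => W.Pairwise E) (clique E v) ↔
      ∃ w, IsParent E w v ∧ higherAdj E w = clique E v := by
  refine ⟨fun hnot => ?_, fun ⟨w, hw, heq⟩ => not_maximal_clique_of_child hEs hEm hw heq⟩
  -- a complete strict superset `W'` of `col(v)`, with lowest vertex `u ≺ v`
  obtain ⟨W', hlt, hW'⟩ := (not_maximal_subset_iff (pairwise_clique hEs hEm v)).mp hnot
  obtain ⟨u, hu, humin⟩ := Set.exists_min_image W' id (Set.toFinite _)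
    ⟨v, hlt.subset (mem_clique_self E v)⟩
  have huleast : IsLeast W' u := ⟨hu, fun w hw => humin w hw⟩
  have hW'u : W' ⊆ clique E u := subset_clique_of_pairwise_of_isLeast hW' huleast
  have huv : u < v := by
    rcases lt_or_eq_of_le (huleast.2 (hlt.subset (mem_clique_self E v))) with h | h
    · exact h
    · exfalso
      subst h
      exact hlt.ne (Set.Subset.antisymm hlt.subset hW'u)
  -- the set `T` of vertices `u' ≺ v` with `col(v) ⊆ adj⁺(u')` is nonempty; take its largest member
  set T : Set ι := {u' | u' < v ∧ clique E v ⊆ higherAdj E u'} with hT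
  have huT : u ∈ T := by
    refine ⟨huv, fun x hx => mem_higherAdj_of_mem_clique_of_ne (hW'u (hlt.subset hx)) ?_⟩
    exact fun hxu => absurd (le_of_mem_clique hx) (not_le.mpr (hxu ▸ huv))
  obtain ⟨m, hm, hmmax⟩ := Set.exists_max_image T id (Set.toFinite _) ⟨u, huT⟩
  have hvm : v ∈ higherAdj E m := hm.2 (mem_clique_self E v)
  obtain ⟨w, hw⟩ := exists_isParent (E := E) ⟨v, hvm⟩
  have hwv : w ≤ v := hw.le hvm
  rcases lt_or_eq_of_le hwv with hlt' | rfl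
  · -- `w ≺ v`: then `w ∈ T` with `w ≻ m`, contradicting the maximality of `m`
    exfalso
    have hwT : w ∈ T := by
      refine ⟨hlt', fun x hx => mem_higherAdj_of_mem_clique_of_ne
        (higherAdj_subset_clique_parent hEm hw (hm.2 hx)) ?_⟩
      exact fun hxw => absurd (le_of_mem_clique hx) (not_le.mpr (hxw ▸ hlt'))
    exact absurd (hmmax w hwT) (not_le.mpr hw.lt)
  · -- `w = v`: `m` is a child of `v` with `col(v) ⊆ adj⁺(m) ⊆ col(p(m)) = col(v)`
    exact ⟨m, hw, Set.Subset.antisymm (higherAdj_subset_clique_parent hEm hw) hm.2⟩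

/-- [VA15, Thm 4.2] verbatim, in terms of higher degrees: `v` is a representative vertex
(`col(v)` is a clique) iff `deg⁺(w) < deg⁺(v) + 1` for every child `w` of `v`.
[cite: VandenbergheAndersen2015, §4.4 Thm 4.2 eq. (4.6) (p. 282)] -/
theorem maximal_clique_iff_forall_child_ncard_lt [Finite ι] {E : ι → ι → Prop}
    (hEs : ∀ ⦃i j : ι⦄, E i j → E j i) (hEm : MonotoneTransitive E) (v : ι) :
    Maximal (fun W : Set ι => W.Pairwise E) (clique E v) ↔
      ∀ w, IsParent E w v → (higherAdj E w).ncard < (higherAdj E v).ncard + 1 := by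
  rw [← not_iff_not, not_maximal_clique_iff_exists_child hEs hEm v]
  push Not
  refine exists_congr fun w => and_congr_right fun hw => ?_
  obtain ⟨hle, hiff⟩ := ncard_higherAdj_le_parent hEm hw
  rw [← hiff]
  constructor
  · intro h
    exact h.ge
  · intro h
    exact le_antisymm hle h

/-- `SimpleGraph` form of the representative-vertex theorem: for a graph whose vertex order is a
perfect elimination ordering, every maximal clique (`Maximal G.IsClique`) is `col(v)` of its
lowest vertex. [cite: VandenbergheAndersen2015, §4.4 (p. 282)] -/
theorem simpleGraph_eq_clique_of_maximal_isClique [Finite ι] (G : SimpleGraph ι)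
    (hG : MonotoneTransitive G.Adj) {W : Set ι} (hW : Maximal G.IsClique W) (hne : W.Nonempty) :
    ∃ v, IsLeast W v ∧ W = clique G.Adj v :=
  eq_clique_of_maximal_pairwise (fun _ _ h => G.adj_symm h) hG hW hne

end Cliques

end ChordalSparsity

end Literature.LinearAlgebra.Matrix
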